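import Mathlib
import Literature.Probability.RandomPlanarGeometry.ChordalCurveFamily
import Summits.CriticalPhenomena.SAWScalingLimit.Theses.SAWDefectDecoherence
import Summits.CriticalPhenomena.SAWScalingLimit.Theorems.SAWDefectDecoherenceObservableToSLEROrientation
import Summits.CriticalPhenomena.SAWScalingLimit.Theorems.SAWDefectDecoherenceObservableToSLERGateDefs
import Summits.CriticalPhenomena.SAWScalingLimit.Theorems.SAWDefectDecoherenceObservableToSLEROrientationCoOrientedLattice
import Summits.CriticalPhenomena.SAWScalingLimit.Theorems.SAWDefectDecoherenceObservableToSLEROrientationCoOrientedContinuum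
import Summits.CriticalPhenomena.SAWScalingLimit.Theorems.SAWDevelopingMapInteriorFlatteningLiouvilleTransportA

/-!
# Stub 3a `stub_orientationCoOriented` of the line `bridge-gate-renewal` (crux
`SAWDefectDecoherence.ObservableToSLER`, stmt-CriticalPhenomena-14005, reshape r4): the co-oriented
orientation transfer `R → R6co`

`HexObservableLimitR` (item stmt-CriticalPhenomena-14003; ψ-averaged DCS Conjecture 2 for Dobrushin
domains flat-pinned at both marked points with exact half-lattice discretisation, orientation
HORIZONTAL / domain above: flat clause `{im p_i < im z}`, lattice clause `m_i ≤ v.1 1`) implies the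
same statement with ONE free lattice orientation `j : Fin 6` used at BOTH balls (flat clause
`0 < im(conj(ζ^j)(z − p_i))`, lattice clause `m_i ≤ rowOf j v`) — the six co-oriented classes
`(j, j)` of the lead's `R6`, with the same universal constant `c`.

Proof (global `60°`-rotation covariance).  Given data `(D, Λ, m, a, b, Φ, L, L_b, ψ)` of class
`(j, j)`, rotate everything back to class `(0, 0)` with `u = ζ^j`, `T = σ^{-j}`
(`hexRotIso`, helper `…CoOrientedLattice`): `D₀ = conj(u) D` (`MarkedDomain.map`), `Λ₀ = T Λ`,
`a₀, b₀ = T a, T b`, `m₀ = m − (0,1,1,1,0,0)_j` (shift table `rowOf_hexRotIso`), `Φ₀ = Φ ∘ (u ·)`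
(`rotCE`), `L₀ = L ∘ (u ·) + j iπ/3`, `L_{b,0} = L_b + j iπ/3`, `ψ₀ = ψ ∘ (u ·)`; the twelve
hypotheses of `R` hold for the rotated data (`discreteData_rot`, `compactExhaustion_rot` below and
the continuum transports of helper `…CoOrientedContinuum`), and the conclusion of `R` for the rotated
data IS the conclusion for the original data: the observable sum is invariant termwise
(`finsum_obs_rot`: re-indexing of the domain mid-edges by `Sym2.map T` and the invariance
`hexParafermionicObservable_image` of the DCS observable under lattice automorphisms acting by
similarities, from `…InteriorFlatteningLiouvilleTransportA`), the normaliser `F(b)` is invariant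
(`obs_rot_at`), and the limit integral is invariant (`limit_integral_rot`).

Sources: refuter audit `Cruxes/ObservableToSLER/Disproof.lean` §8 ("co-tilted pairs need the provable
`60°`-rotation covariance"); H. Duminil-Copin, S. Smirnov, Ann. of Math. 175 (2012)
(arXiv:1007.0575) §2.  No definition is introduced.
-/

noncomputable section

open scoped BigOperators Topology ComplexConjugate
open Filter Set MeasureTheory Metric
open Literature.Probability.LatticeModels (HexVertex hexGraph hexCenter triZeta triEmbed Site
  triZeta_sq normSq_triZeta)
open Literature.Probability.RandomPlanarGeometry
open Literature.Probability.RandomPlanarGeometry.SAW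
open Summit.CriticalPhenomena.SAWScalingLimit.Theorems.InteriorFlattening.Liouville

namespace Summit.CriticalPhenomena.SAWScalingLimit.Theorems.ObservableToSLER.BridgeGate

namespace CoOriented

/-! ### Lattice transports under `T = σ^{-j}` -/

variable {u : ℂ}

/-- **The observable sum is rotation invariant, termwise.**  For a graph automorphism `T` acting on
face centres by `c(T f) = conj(u) · c(f)` (`‖u‖ = 1`), re-indexing the domain mid-edges by
`Sym2.map T` (a bijection `hexDomainMidEdges Λ → hexDomainMidEdges (T Λ)`) and the invariance of
the parafermionic observable (`hexParafermionicObservable_image`) give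
`Σ_{e ∈ Ω(TΛ)} ψ(u · δ mid e) F_{TΛ, Ta}(e) = Σ_{e ∈ Ω(Λ)} ψ(δ mid e) F_{Λ, a}(e)`. -/
theorem finsum_obs_rot (hu : ‖u‖ = 1) (T : hexGraph ≃g hexGraph)
    (hT : ∀ f, hexCenter (T f) = conj u * hexCenter f + 0) (Λ : Finset HexVertex)
    (a : Sym2 HexVertex) (x σ δ : ℝ) (ψ : ℂ → ℂ) :
    ∑ᶠ e ∈ hexDomainMidEdges (Λ.image T),
        ψ (u * ((δ : ℂ) * hexMidpoint e)) *
          hexParafermionicObservable (Λ.image T) (a.map T) x σ e =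
      ∑ᶠ e ∈ hexDomainMidEdges Λ,
        ψ ((δ : ℂ) * hexMidpoint e) * hexParafermionicObservable Λ a x σ e := by
  have hα : conj u ≠ 0 := conj_ne_zero_of_norm_one hu
  symm
  refine finsum_mem_eq_of_bijOn (Sym2.map T) ⟨fun e he => ?_, ?_, fun e' he' => ?_⟩ fun e he => ?_
  · exact (Transport.map_mem_hexDomainMidEdges_iff T Λ e).2 he
  · exact (Sym2.map.injective T.injective).injOn
  · refine ⟨e'.map T.symm, ?_, Transport.map_map_symm T e'⟩
    have h := Transport.map_mem_hexDomainMidEdges_iff T Λ (e'.map T.symm)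
    rw [Transport.map_map_symm] at h
    exact h.1 he'
  · rw [Transport.hexParafermionicObservable_image T hα hT, Transport.hexMidpoint_map T hT,
      add_zero, mul_left_comm (δ : ℂ), mul_conj_mul hu]

/-- **The normaliser is rotation invariant:** `F_{TΛ, Ta}(Tb) = F_{Λ, a}(b)`. -/
theorem obs_rot_at (hu : ‖u‖ = 1) (T : hexGraph ≃g hexGraph)
    (hT : ∀ f, hexCenter (T f) = conj u * hexCenter f + 0) (Λ : Finset HexVertex)
    (a b : Sym2 HexVertex) (x σ : ℝ) :
    hexParafermionicObservable (Λ.image T) (a.map T) x σ (b.map T) =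
      hexParafermionicObservable Λ a x σ b :=
  Transport.hexParafermionicObservable_image T (conj_ne_zero_of_norm_one hu) hT Λ a b x σ

/-- **Transport of the admissible discretisation data of class `(j, j)` to class `(0, 0)`** under
`T = σ^{-j}` (`σ = hexRot60`): simple connectivity, boundary mid-edges, walks, connectivity, "inside
the domain", and the exact half-lattice clause — which becomes the ROW clause `m − c_j ≤ v.1 1` of
`HexObservableLimitR` by the shift table `rowOf_hexRotIso`. -/
theorem discreteData_rot (j : Fin 6) {Ω : Set ℂ} {p : Fin 2 → ℂ} {ρ δ : ℝ} {Λ : Finset HexVertex}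
    {m : Fin 2 → ℤ} {a b : Sym2 HexVertex}
    (h : hexDomainSimplyConnected Λ ∧ a ∈ hexDomainBoundary Λ ∧ b ∈ hexDomainBoundary Λ ∧
      Nonempty (HexMidEdgeSAW Λ a b) ∧
      (hexGraph.induce ((Λ : Finset HexVertex) : Set HexVertex)).Preconnected ∧
      (∀ v ∈ Λ, (δ : ℂ) * hexCenter v ∈ Ω) ∧
      (∀ i : Fin 2, ∀ v : HexVertex, (δ : ℂ) * hexCenter v ∈ ball (p i) ρ →
        (v ∈ Λ ↔ m i ≤ rowOf j v))) :
    hexDomainSimplyConnected (Λ.image (hexRotIso (j : ℕ)).symm) ∧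
      a.map (hexRotIso (j : ℕ)).symm ∈ hexDomainBoundary (Λ.image (hexRotIso (j : ℕ)).symm) ∧
      b.map (hexRotIso (j : ℕ)).symm ∈ hexDomainBoundary (Λ.image (hexRotIso (j : ℕ)).symm) ∧
      Nonempty (HexMidEdgeSAW (Λ.image (hexRotIso (j : ℕ)).symm) (a.map (hexRotIso (j : ℕ)).symm)
        (b.map (hexRotIso (j : ℕ)).symm)) ∧
      (hexGraph.induce ((Λ.image (hexRotIso (j : ℕ)).symm : Finset HexVertex) :
        Set HexVertex)).Preconnected ∧
      (∀ v ∈ Λ.image (hexRotIso (j : ℕ)).symm, (δ : ℂ) * hexCenter v ∈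
        (Homeomorph.mulLeft₀ (conj (triZeta ^ (j : ℕ)))
          (conj_ne_zero_of_norm_one (norm_triZeta_pow (j : ℕ)))) '' Ω) ∧
      (∀ i : Fin 2, ∀ v : HexVertex,
        (δ : ℂ) * hexCenter v ∈ ball (conj (triZeta ^ (j : ℕ)) * p i) ρ →
        (v ∈ Λ.image (hexRotIso (j : ℕ)).symm ↔
          m i - (![0, 1, 1, 1, 0, 0] : Fin 6 → ℤ) j ≤ v.1 1)) := by
  obtain ⟨hsc, ha, hb, ⟨γ⟩, hconn, hin, hrow⟩ := h
  set T := (hexRotIso (j : ℕ)).symm with hT_def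
  have hu : ‖triZeta ^ (j : ℕ)‖ = 1 := norm_triZeta_pow _
  refine ⟨(Transport.hexDomainSimplyConnected_image_iff T Λ).2 hsc,
    (Transport.map_mem_hexDomainBoundary_iff T Λ a).2 ha,
    (Transport.map_mem_hexDomainBoundary_iff T Λ b).2 hb,
    Transport.exists_walk_map T (fun v hv => Finset.mem_image_of_mem _ hv) rfl rfl γ |>.nonempty,
    ?_, ?_, ?_⟩
  · rw [Finset.coe_image]
    exact (Transport.preconnected_induce_image_iff T _).2 hconn
  · intro v hv
    obtain ⟨w, hw, rfl⟩ := Finset.mem_image.1 hv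
    rw [mem_image_mulLeft_conj_iff hu, hT_def, hexCenter_hexRotIso_symm, mul_left_comm,
      mul_conj_mul hu]
    exact hin w hw
  · intro i v hv
    rw [hT_def, mem_image_hexRotIso_symm_iff, hrow i (hexRotIso (j : ℕ) v), rowOf_hexRotIso,
      rowOf_zero]
    · omega
    · rw [hexCenter_hexRotIso, mul_left_comm, mul_mem_ball_iff hu]
      exact hv

/-- **Transport of the compact-exhaustion clause** ("Λ_δ exhausts compacts of the domain"). -/
theorem compactExhaustion_rot (n : ℕ) {Ω : Set ℂ} {Λ : ℝ → Finset HexVertex}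
    (hK : ∀ K : Set ℂ, IsCompact K → K ⊆ Ω → ∀ᶠ δ : ℝ in 𝓝[>] 0,
      ∀ v : HexVertex, (δ : ℂ) * hexCenter v ∈ K → v ∈ Λ δ) :
    ∀ K : Set ℂ, IsCompact K →
      K ⊆ (Homeomorph.mulLeft₀ (conj (triZeta ^ n))
        (conj_ne_zero_of_norm_one (norm_triZeta_pow n))) '' Ω →
      ∀ᶠ δ : ℝ in 𝓝[>] 0, ∀ v : HexVertex, (δ : ℂ) * hexCenter v ∈ K →
        v ∈ (Λ δ).image (hexRotIso n).symm := by
  intro K hKc hKΩ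
  have hu : ‖triZeta ^ n‖ = 1 := norm_triZeta_pow n
  set K' : Set ℂ := (fun z => triZeta ^ n * z) '' K with hK'
  have hK'c : IsCompact K' := hKc.image (continuous_const_mul _)
  have hK'Ω : K' ⊆ Ω := by
    rintro _ ⟨k, hk, rfl⟩
    exact (mem_image_mulLeft_conj_iff hu Ω k).1 (hKΩ hk)
  filter_upwards [hK K' hK'c hK'Ω] with δ hδ v hv
  rw [mem_image_hexRotIso_symm_iff]
  apply hδ
  rw [hexCenter_hexRotIso, mul_left_comm]
  exact mem_image_of_mem _ hv

end CoOriented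

/-! ### The stub -/

open CoOriented
open Summit.CriticalPhenomena.SAWScalingLimit.Theses.SAWDefectDecoherence (HexObservableLimitR)

/-- STUB 3a — **CO-ORIENTED ORIENTATION TRANSFER `R → R6co`** (line `bridge-gate-renewal`, reshape
r4).  `HexObservableLimitR` (class `(0, 0)`: horizontal flat pieces, domain above, exact
half-lattice `m ≤ v.1 1` at both marked points) implies the same statement for the six co-oriented
classes `(j, j)`, `j : Fin 6` (flat clause `0 < im(conj(ζ^j)(z − p_i))`, lattice clause
`m ≤ rowOf j v`), with the SAME universal constant.  Proof: rotate all the data back by `ζ^{-j}` —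
`D ↦ conj(ζ^j) D` (`MarkedDomain.map`), `Λ_δ ↦ σ^{-j} Λ_δ`, `a_δ, b_δ ↦ σ^{-j}(·)`,
`m_i ↦ m_i − c_j` (shift table `rowOf_hexRotIso`), `Φ ↦ Φ ∘ (ζ^j ·)` (`rotCE`),
`L ↦ L ∘ (ζ^j ·) + j iπ/3`, `L_b ↦ L_b + j iπ/3`, `ψ ↦ ψ ∘ (ζ^j ·)` — check the twelve hypotheses
of `R` for the rotated data (`flat_clause_rot`, `discreteData_rot`, `compactExhaustion_rot`, the
`Tendsto`/chain-rule/support transports), apply `R`, and transport the conclusion back: the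
observable sum is invariant termwise (`finsum_obs_rot`, `obs_rot_at`: bijection of mid-edge SAWs with
equal lengths and windings, `hexParafermionicObservable_image`) and so is the limit integral
(`limit_integral_rot`: `L₀ − L_{b,0} = (L − L_b) ∘ (ζ^j ·)`, Lebesgue measure is rotation invariant). -/
theorem stub_orientationCoOriented :
    HexObservableLimitR →
    ∃ c : ℂ, c ≠ 0 ∧ ∀ (D : DobrushinDomain) (ρ : ℝ) (j : Fin 6)
      (Λ : ℝ → Finset HexVertex) (m : Fin 2 → ℝ → ℤ) (a b : ℝ → Sym2 HexVertex)
      (Φ : ConformalEquiv D.carrier UpperHalfPlane.upperHalfPlaneSet) (L : ℂ → ℂ) (Lb : ℂ) (ψ : ℂ → ℂ),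
      let F : ℝ → Sym2 HexVertex → ℂ := fun δ z =>
        hexParafermionicObservable (Λ δ) (a δ) hexCriticalFugacity (5 / 8) z
      0 < ρ →
      (∀ i : Fin 2, D.carrier ∩ ball (D.pt i) ρ =
        {z : ℂ | 0 < (starRingEnd ℂ (triZeta ^ (j : ℕ)) * (z - D.pt i)).im} ∩ ball (D.pt i) ρ) →
      (∀ᶠ δ : ℝ in 𝓝[>] 0,
        hexDomainSimplyConnected (Λ δ) ∧ a δ ∈ hexDomainBoundary (Λ δ) ∧
          b δ ∈ hexDomainBoundary (Λ δ) ∧ Nonempty (HexMidEdgeSAW (Λ δ) (a δ) (b δ)) ∧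
          (hexGraph.induce ((Λ δ : Finset HexVertex) : Set HexVertex)).Preconnected ∧
          (∀ v ∈ Λ δ, (δ : ℂ) * hexCenter v ∈ D.carrier) ∧
          (∀ i : Fin 2, ∀ v : HexVertex, (δ : ℂ) * hexCenter v ∈ ball (D.pt i) ρ →
            (v ∈ Λ δ ↔ m i δ ≤ rowOf j v))) →
      (∀ K : Set ℂ, IsCompact K → K ⊆ D.carrier → ∀ᶠ δ : ℝ in 𝓝[>] 0,
        ∀ v : HexVertex, (δ : ℂ) * hexCenter v ∈ K → v ∈ Λ δ) →
      Tendsto (fun δ : ℝ => (δ : ℂ) * hexMidpoint (a δ)) (𝓝[>] 0) (𝓝 (D.pt 0)) →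
      Tendsto (fun δ : ℝ => (δ : ℂ) * hexMidpoint (b δ)) (𝓝[>] 0) (𝓝 (D.pt 1)) →
      Tendsto (fun x => ‖Φ x‖) (𝓝[D.carrier] (D.pt 0)) atTop →
      Φ.HasBoundaryValue (D.pt 1) 0 →
      ContinuousOn L D.carrier → (∀ z ∈ D.carrier, Complex.exp (L z) = deriv Φ z) →
      Tendsto L (𝓝[D.carrier] (D.pt 1)) (𝓝 Lb) →
      Continuous ψ → HasCompactSupport ψ → tsupport ψ ⊆ D.carrier →
      Tendsto (fun δ : ℝ => (δ : ℂ) ^ 2 * (∑ᶠ e ∈ hexDomainMidEdges (Λ δ),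
        ψ ((δ : ℂ) * hexMidpoint e) * F δ e) / F δ (b δ)) (𝓝[>] 0)
        (𝓝 (c * ∫ z, ψ z * Complex.exp ((5 / 8 : ℂ) * (L z - Lb)))) := by
  rintro ⟨c, hc, H⟩
  refine ⟨c, hc, ?_⟩
  intro D ρ j Λ m a b Φ L Lb ψ F hρ hflat hdisc hK ha hb hΦ hΦb hL hexp hLb hψ hψK hψD
  -- the rotation data
  set n : ℕ := (j : ℕ) with hn
  have hu1 : ‖triZeta ^ n‖ = 1 := norm_triZeta_pow n
  set u : ℂ := triZeta ^ n with hu_def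
  have hu0 : u ≠ 0 := ne_zero_of_norm_one hu1
  have hcu0 : conj u ≠ 0 := conj_ne_zero_of_norm_one hu1
  set φ : ℂ ≃ₜ ℂ := Homeomorph.mulLeft₀ (conj u) hcu0 with hφ_def
  set T : hexGraph ≃g hexGraph := (hexRotIso n).symm with hT_def
  have hT : ∀ f, hexCenter (T f) = conj u * hexCenter f + 0 := hexCenter_hexRotIso_symm_affine n
  -- the rotated data
  set D₀ : DobrushinDomain := D.map φ with hD₀_def
  have hmem : ∀ z, z ∈ D₀.carrier ↔ u * z ∈ D.carrier := mem_image_mulLeft_conj_iff hu1 D.carrier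
  have hpt : ∀ i, D₀.pt i = conj u * D.pt i := fun i => rfl
  set Λ₀ : ℝ → Finset HexVertex := fun δ => (Λ δ).image T with hΛ₀_def
  set m₀ : Fin 2 → ℝ → ℤ := fun i δ => m i δ - (![0, 1, 1, 1, 0, 0] : Fin 6 → ℤ) j with hm₀_def
  set a₀ : ℝ → Sym2 HexVertex := fun δ => (a δ).map T with ha₀_def
  set b₀ : ℝ → Sym2 HexVertex := fun δ => (b δ).map T with hb₀_def
  set Φ₀ : ConformalEquiv D₀.carrier UpperHalfPlane.upperHalfPlaneSet :=
    rotCE Φ u hu0 D₀.carrier hmem with hΦ₀_def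
  set cL : ℂ := (n : ℂ) * (Real.pi * Complex.I / 3) with hcL_def
  have hcL : Complex.exp cL = u := by
    rw [hu_def, hcL_def, Complex.exp_nat_mul]
    rfl
  set L₀ : ℂ → ℂ := fun z => L (u * z) + cL with hL₀_def
  set Lb₀ : ℂ := Lb + cL with hLb₀_def
  set ψ₀ : ℂ → ℂ := fun z => ψ (u * z) with hψ₀_def
  -- the twelve hypotheses of `R` for the rotated data
  have hflat' : ∀ i : Fin 2, D₀.carrier ∩ ball (D₀.pt i) ρ =
      {z : ℂ | (D₀.pt i).im < z.im} ∩ ball (D₀.pt i) ρ := fun i => by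
    rw [hpt i]
    exact flat_clause_rot hu1 (hflat i)
  have hdisc' : ∀ᶠ δ : ℝ in 𝓝[>] 0,
      hexDomainSimplyConnected (Λ₀ δ) ∧ a₀ δ ∈ hexDomainBoundary (Λ₀ δ) ∧
        b₀ δ ∈ hexDomainBoundary (Λ₀ δ) ∧ Nonempty (HexMidEdgeSAW (Λ₀ δ) (a₀ δ) (b₀ δ)) ∧
        (hexGraph.induce ((Λ₀ δ : Finset HexVertex) : Set HexVertex)).Preconnected ∧
        (∀ v ∈ Λ₀ δ, (δ : ℂ) * hexCenter v ∈ D₀.carrier) ∧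
        (∀ i : Fin 2, ∀ v : HexVertex, (δ : ℂ) * hexCenter v ∈ ball (D₀.pt i) ρ →
          (v ∈ Λ₀ δ ↔ m₀ i δ ≤ v.1 1)) :=
    hdisc.mono fun δ hδ => discreteData_rot j hδ
  have hK' : ∀ K : Set ℂ, IsCompact K → K ⊆ D₀.carrier → ∀ᶠ δ : ℝ in 𝓝[>] 0,
      ∀ v : HexVertex, (δ : ℂ) * hexCenter v ∈ K → v ∈ Λ₀ δ :=
    compactExhaustion_rot n hK
  have ha' : Tendsto (fun δ : ℝ => (δ : ℂ) * hexMidpoint (a₀ δ)) (𝓝[>] 0) (𝓝 (D₀.pt 0)) := by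
    have e : (fun δ : ℝ => (δ : ℂ) * hexMidpoint (a₀ δ)) =
        fun δ : ℝ => (δ : ℂ) * (conj u * hexMidpoint (a δ) + 0) := by
      funext δ; rw [ha₀_def, Transport.hexMidpoint_map T hT]
    rw [e, hpt]
    exact tendsto_mul_midpoint (conj u) ha
  have hb' : Tendsto (fun δ : ℝ => (δ : ℂ) * hexMidpoint (b₀ δ)) (𝓝[>] 0) (𝓝 (D₀.pt 1)) := by
    have e : (fun δ : ℝ => (δ : ℂ) * hexMidpoint (b₀ δ)) =
        fun δ : ℝ => (δ : ℂ) * (conj u * hexMidpoint (b δ) + 0) := by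
      funext δ; rw [hb₀_def, Transport.hexMidpoint_map T hT]
    rw [e, hpt]
    exact tendsto_mul_midpoint (conj u) hb
  have hΦ' : Tendsto (fun x => ‖Φ₀ x‖) (𝓝[D₀.carrier] (D₀.pt 0)) atTop := by
    rw [hpt]
    exact tendsto_norm_comp_mul_atTop hu1 hΦ
  have hΦb' : Φ₀.HasBoundaryValue (D₀.pt 1) 0 := by
    rw [ConformalEquiv.HasBoundaryValue, hpt]
    exact tendsto_comp_mul_nhdsWithin hu1 hΦb
  have hL' : ContinuousOn L₀ D₀.carrier := continuousOn_comp_mul_add hu1 hL cL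
  have hexp' : ∀ z ∈ D₀.carrier, Complex.exp (L₀ z) = deriv Φ₀ z :=
    exp_comp_mul_add_eq_deriv hu1 D.isOpen Φ.differentiableOn hexp hcL
  have hLb' : Tendsto L₀ (𝓝[D₀.carrier] (D₀.pt 1)) (𝓝 Lb₀) := by
    rw [hpt]
    exact (tendsto_comp_mul_nhdsWithin hu1 hLb).add_const cL
  have hψ' : Continuous ψ₀ := continuous_comp_mul hψ u
  have hψK' : HasCompactSupport ψ₀ := hasCompactSupport_comp_mul hu1 hψK
  have hψD' : tsupport ψ₀ ⊆ D₀.carrier := tsupport_comp_mul_subset hu1 hψD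
  -- apply `R` to the rotated data
  have key := H D₀ ρ Λ₀ m₀ a₀ b₀ Φ₀ L₀ Lb₀ ψ₀ hρ hflat' hdisc' hK' ha' hb' hΦ' hΦb' hL' hexp' hLb'
    hψ' hψK' hψD'
  -- transport the conclusion back
  have hlim : (∫ z, ψ₀ z * Complex.exp ((5 / 8 : ℂ) * (L₀ z - Lb₀))) =
      ∫ z, ψ z * Complex.exp ((5 / 8 : ℂ) * (L z - Lb)) :=
    limit_integral_rot hu1 ψ L Lb cL (5 / 8)
  rw [hlim] at key
  refine key.congr fun δ => ?_
  show (δ : ℂ) ^ 2 * (∑ᶠ e ∈ hexDomainMidEdges ((Λ δ).image T),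
      ψ (u * ((δ : ℂ) * hexMidpoint e)) *
        hexParafermionicObservable ((Λ δ).image T) ((a δ).map T) hexCriticalFugacity (5 / 8) e) /
      hexParafermionicObservable ((Λ δ).image T) ((a δ).map T) hexCriticalFugacity (5 / 8)
        ((b δ).map T) =
    (δ : ℂ) ^ 2 * (∑ᶠ e ∈ hexDomainMidEdges (Λ δ),
      ψ ((δ : ℂ) * hexMidpoint e) * F δ e) / F δ (b δ)
  rw [finsum_obs_rot hu1 T hT, obs_rot_at hu1 T hT]

end Summit.CriticalPhenomena.SAWScalingLimit.Theorems.ObservableToSLER.BridgeGate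

end
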